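import Literature.NumberTheory.EllipticCurves.ZpExtensionAnticyclotomicRingClassSplittingProofs
import Literature.NumberTheory.EllipticCurves.AnticyclotomicTowerSharpOfSplittingProofs
import HarnessLib

/-!
# The anticyclotomic tower inside the ring class tower: `K_k ⊆ K[p^{k+1}]` at every class number
# (Perrin-Riou 1987 §3.2; Howard 2004 §3.3; Cox 2013 §9.A / Thm. 11.1) — THEOREMS ONLY

Topic `NumberTheory/EllipticCurves` (complex multiplication / Iwasawa theory); namespaces
`Literature.NumberTheory.EllipticCurves`.  THEOREMS ONLY (no definition, no
named fact, no instance; D-0026).  Cell `pub/bsd-print-x9`, seat `x10b-p1-w2`: kernel discharge of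
the support item `AnticyclotomicTowerSharp` (binder `hTw` of the deciding theorems of the routes
PrintX9 / PrintX10b; the registered stub `stub_anticyclotomicTowerSharp` of the crux
`BeyondCarrierDepthX10b`), stated VERBATIM as filed:

  `anticyclotomicTowerSharp : ∀ K p, Odd p → IsImaginaryQuadratic K → ∀ κ, κ.IsAnticyclotomic →
     ∀ jbar k, ringClassSubgroup K (p ^ (k + 1)) jbar ≤ κ.layerSubgroup k`

— for `K` imaginary quadratic, `p` odd and `κ` ANY anticyclotomic `ℤ_p`-extension, the `k`-th layer
`K_k = K̄^{κ⁻¹(p^kℤ_p)}` lies in the ring class field `K[p^{k+1}]` of conductor `p^{k+1}` (realised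
in `ℂ` through `jbar : K̄ → ℂ` as the tree's `ringClassField`, with `Gal(K̄/K[c]) = ringClassSubgroup K c jbar`),
at EVERY class number `h_K` (Perrin-Riou 1987 §3.2: `D_n := H_{p^n} ∩ D_∞` has degree `p^{n-1}`
over `D_1 ⊇ K`; Howard 2004 §3.3 under `p ∤ h_K`: "`K_k` is the maximal `p`-power subextension of
`K[p^{k+1}]/K`").

## Proof

The thin composition (cell ruling, LEAD `bsd-line-x10b-p1` 2026-08-29) of the two tree inputs:
* the SPLITTING LETTER `ZpExtension.mem_splitPrimes_layer_of_eq_span_of_sub_intCast_mem`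
  (`ZpExtensionAnticyclotomicRingClassSplittingProofs`): every prime `v ∤ p` with `𝔭_v = (α)`,
  `α ≡ n (mod p^{k+1})`, `p ∤ n` splits completely in `K_k` (idelic: the idelic character of `κ`
  takes values in `p^kℤ_p` on `⟨K_vˣ⟩`; product formula, anticyclotomic sign, odd-`p` local units);
* the Galois/Bauer socket `ringClassSubgroup_pow_succ_le_layerSubgroup_of_principal_splits`
  (`AnticyclotomicTowerSharpOfSplittingProofs`): the ring class field of conductor `p^{k+1}` as a
  class field (Cox Thm. 11.1), Bauer's theorem, and the transport along `jbar`.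

## References

* B. Perrin-Riou, *Fonctions L p-adiques, théorie d'Iwasawa et points de Heegner*, Bull. SMF 115
  (1987), §3.2 (pp. 430–431). [PerrinRiou1987BSMF]
* B. Howard, *The Heegner point Kolyvagin system*, Compos. Math. 140 (2004), §3.3. [Howard2004HeegnerKolyvagin]
* D. A. Cox, *Primes of the form x² + ny²*, 2nd ed. (2013), §7.D Thm. 7.24, §9.A Thm. 9.2, §11.A
  Thm. 11.1. [Cox2013]
* F. Castella, G. Grossi, J. Lee, C. Skinner, Invent. Math. 227 (2022), §4.1 (`d(k)`). [CastellaGrossiLeeSkinner2022]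
* J. Neukirch, *Algebraic Number Theory* (1999), Ch. VII (13.9) (Bauer). [NeukirchANT1999]

## Tree search

`lean search 'ringClassSubgroup .* ≤ .*layerSubgroup'`: hypotheses only (`hTw1` of the Heegner-geometry
files, `StabilizedHeegnerData.layer_le`); no prior proof.
-/

noncomputable section

namespace Literature.NumberTheory.EllipticCurves

/-- **The anticyclotomic tower inside the ring class tower — the filed statement
`AnticyclotomicTowerSharp` verbatim** (support item of the routes PrintX9 / PrintX10b; registered
stub `stub_anticyclotomicTowerSharp` of the crux `BeyondCarrierDepthX10b`): for every imaginary
quadratic `K`, every odd prime `p`, every anticyclotomic `ℤ_p`-extension `κ`, every `jbar : K̄ → ℂ`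
and every `k`, `Gal(K̄/K[p^{k+1}]) ≤ Gal(K̄/K_k)`, i.e. `K_k ⊆ K[p^{k+1}]`, at every class number.
[cite: PerrinRiou1987BSMF, §3.2 (pp. 430–431)] [cite: Howard2004HeegnerKolyvagin, §3.3]
[cite: Cox2013, §7.D Thm. 7.24 and §9.A] -/
theorem anticyclotomicTowerSharp :
    ∀ (K : Type) [Field K] [NumberField K] (p : ℕ) [Fact p.Prime], Odd p →
    IsImaginaryQuadratic K →
    ∀ (κ : ZpExtension K p), κ.IsAnticyclotomic →
    ∀ (jbar : AlgebraicClosure K →+* ℂ) (k : ℕ),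
    ringClassSubgroup K (p ^ (k + 1)) jbar ≤ κ.layerSubgroup k := by
  intro K _ _ p _ hp hK κ hκ jbar k
  have hp2 : p ≠ 2 := by rintro rfl; exact (Nat.not_odd_iff_even.mpr (by decide)) hp
  exact ringClassSubgroup_pow_succ_le_layerSubgroup_of_principal_splits hK κ jbar k
    fun v α n hpv hn hα hdvd ↦
      ZpExtension.mem_splitPrimes_layer_of_eq_span_of_sub_intCast_mem hK hp2 κ hκ k hpv hα hn
        (Ideal.mem_span_singleton'.mpr (by obtain ⟨c, hc⟩ := hdvd; exact ⟨c, by rw [mul_comm]; exact hc.symm⟩))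

end Literature.NumberTheory.EllipticCurves

end
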